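import Mathlib
import HarnessLib
import Literature.Geometry.DiscreteGeometry.BondGraph
import Literature.Geometry.DiscreteGeometry.KissingPatterns
import Summits.AtomisticToContinuum.Crystallization.Theorems.PricedLinkCensusSoftLayerPropagationStubDevelopFrames
import Summits.AtomisticToContinuum.Crystallization.Theorems.PricedLinkCensusSoftLayerPropagationStubDevelopTriangle

/-!
# One step of the ordered shadow development (crux `SoftLayerPropagation`, line `Sketch`)

Route `PricedLinkCensus`, crux `SoftLayerPropagation` (stmt-AtomisticToContinuum-14233), line
`Sketch`, helper file for the stub `stub_develop` (development of the exact shadow crystal on a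
graph ball): registered sub-goal `develop_step`.

The development is built by processing the sites in the order of a potential `f : Fin N → ℝ`
(ties broken by the index; intended: `f v = dist (y i) (y v)`), keeping frames `D, Q` such that
every edge out of a PROCESSED site is compatible.  `develop_step` adds one site `u` (with
`f u ≤ R₁`): given frames good at every earlier site, it returns frames good at every site
`≤ u`.  The unframed neighbours of `u` receive the extension of the frame of `u`
(`develop_extend`); a neighbour `t` already framed by an earlier site `k` is shown compatible with
`u` by the triangle rule (`develop_triangle`) from three LOCAL hypotheses, which are exactly what
remains to be proved metrically for the crux:

* `HO` (handedness): the charts of two bonded sites in scope give every contact tetrahedron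
  through the bond the same handedness;
* `HX` (no-merge / coned squares): a site `t` outside the star of `x` bonded to two non-bonded
  neighbours `u, k` of `x` is bonded to a common neighbour of `x, u, k` (in a Barlow packing:
  `u, k` span a square of the link of `x` and `t` is the far apex of its octahedron);
* `H1` (ordered caps): if `t` is later than `u ~ t` and `k ~ t` (`k ≁ u`) is earlier than `u`,
  some earlier neighbour of `u` is bonded to `t` or to `k` (in a Barlow packing with
  `f = dist (y i) ·`: the part of the shell of `t` inside a ball is edge-connected, up to the
  inner apex of an inward square).

Charts are functions `Pc, Ac, mc` of the site and must exist (with `nn > 0`) at every site in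
scope (`f ≤ R₁` or a neighbour of such a site).  No new definitions: "charted", "compatible",
"earlier" are written out.  All `[folklore]`.
-/

noncomputable section

namespace Summit.AtomisticToContinuum.Crystallization.Theorems

open Literature.Geometry.DiscreteGeometry

/-- **Registered sub-goal `develop_step`** of the crux item (ONE STEP of the ordered development
of the shadow crystal; hypotheses `HO`, `HX`, `H1` as in the module docstring).  If the frames
`D, Q` are compatible along every edge out of every site earlier than `u` (`f u ≤ R₁`), then
some frames — equal to `D, Q` except at the neighbours of `u` not yet reached — are compatible
along every edge out of every site earlier than or equal to `u`. [folklore] -/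
theorem develop_step :  ∀ (η : ℝ) (N : ℕ) (y : Fin N → EuclideanSpace ℝ (Fin 3)) (Pc : Fin N → Finset (EuclideanSpace ℝ (Fin 3))) (Ac : Fin N → EuclideanSpace ℝ (Fin 3) →ₗᵢ[ℝ] EuclideanSpace ℝ (Fin 3)) (mc : Fin N → EuclideanSpace ℝ (Fin 3) → Fin N) (f : Fin N → ℝ) (R₁ : ℝ),
    (∀ v, (f v ≤ R₁ ∨ ∃ w, (Literature.Geometry.DiscreteGeometry.bondGraph η y).Adj w v ∧ f w ≤ R₁) → 0 < Literature.Geometry.DiscreteGeometry.nearestDist y v ∧ ((Pc v = Literature.Geometry.DiscreteGeometry.fccKissingPattern ∨ Pc v = Literature.Geometry.DiscreteGeometry.hcpKissingPattern) ∧ (∀ p ∈ Pc v, (Literature.Geometry.DiscreteGeometry.bondGraph η y).Adj v (mc v p) ∧ dist (y (mc v p)) (y v + Literature.Geometry.DiscreteGeometry.nearestDist y v • Ac v p) ≤ Literature.Geometry.DiscreteGeometry.nearestDist y v / 4) ∧ (∀ p ∈ Pc v, ∀ q ∈ Pc v, mc v p = mc v q → p = q) ∧ (∀ p ∈ Pc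 v, ∀ q ∈ Pc v, ((Literature.Geometry.DiscreteGeometry.bondGraph η y).Adj (mc v p) (mc v q) ↔ dist p q = 1)) ∧ (∀ l, (Literature.Geometry.DiscreteGeometry.bondGraph η y).Adj v l → ∃ p ∈ Pc v, mc v p = l))) →
    (∀ j k, (f j ≤ R₁ ∨ ∃ w, (Literature.Geometry.DiscreteGeometry.bondGraph η y).Adj w j ∧ f w ≤ R₁) → (f k ≤ R₁ ∨ ∃ w, (Literature.Geometry.DiscreteGeometry.bondGraph η y).Adj w k ∧ f w ≤ R₁) → (Literature.Geometry.DiscreteGeometry.bondGraph η y).Adj j k → (∀ a b, (Literature.Geometry.DiscreteGeometry.bondGraph η y).Adj j a → (Literature.Geometry.DiscreteGeometry.bondGraph η y).Adj j b → (Literature.Geometry.DiscreteGeometry.bondGraph η y).Adj k a → (Literature.Geometry.DiscreteGeometry.bondGraph η y).Adj k b → (Literature.Geometry.DiscreteGeometry.bondGraph η y).Adj a b → ∀ p₁ ∈ Pc j, ∀ p₂ ∈ Pc j, ∀ p₃ ∈ Pc j, mc j p₁ = k → mc j p₂ = a → mc j p₃ = b → ∀ q₁ ∈ Pc k, ∀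 q₂ ∈ Pc k, ∀ q₃ ∈ Pc k, mc k q₁ = j → mc k q₂ = a → mc k q₃ = b → Matrix.det ![WithLp.ofLp p₁, WithLp.ofLp p₂, WithLp.ofLp p₃] = - Matrix.det ![WithLp.ofLp q₁, WithLp.ofLp q₂, WithLp.ofLp q₃])) →
    (∀ x u k t, f x ≤ R₁ → (Literature.Geometry.DiscreteGeometry.bondGraph η y).Adj x u → (Literature.Geometry.DiscreteGeometry.bondGraph η y).Adj x k → ¬ (Literature.Geometry.DiscreteGeometry.bondGraph η y).Adj u k → u ≠ k → ¬ (Literature.Geometry.DiscreteGeometry.bondGraph η y).Adj x t → x ≠ t → (Literature.Geometry.DiscreteGeometry.bondGraph η y).Adj t u → (Literature.Geometry.DiscreteGeometry.bondGraph η y).Adj t k → ∃ c, (Literature.Geometry.DiscreteGeometry.bondGraph η y).Adj x c ∧ (Literature.Geometry.DiscreteGeometry.bondGraph η y).Adj u c ∧ (Literature.Geometry.DiscreteGeometry.bondGraph η y).Adj k c ∧ (Literature.Geometry.DiscreteGeometry.bondGraph η y).Adj t c) →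
    (∀ u t k, f u ≤ R₁ → (Literature.Geometry.DiscreteGeometry.bondGraph η y).Adj u t → (Literature.Geometry.DiscreteGeometry.bondGraph η y).Adj t k → ¬ (Literature.Geometry.DiscreteGeometry.bondGraph η y).Adj u k → u ≠ k → (f k < f u ∨ (f k = f u ∧ k < u)) → (f u < f t ∨ (f u = f t ∧ u < t)) → ∃ c, (Literature.Geometry.DiscreteGeometry.bondGraph η y).Adj u c ∧ (f c < f u ∨ (f c = f u ∧ c < u)) ∧ ((Literature.Geometry.DiscreteGeometry.bondGraph η y).Adj c t ∨ (Literature.Geometry.DiscreteGeometry.bondGraph η y).Adj c k)) →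
    ∀ u, f u ≤ R₁ → ∀ (D : Fin N → EuclideanSpace ℝ (Fin 3)) (Q : Fin N → EuclideanSpace ℝ (Fin 3) →ₗᵢ[ℝ] EuclideanSpace ℝ (Fin 3)),
    (∀ v, (f v < f u ∨ (f v = f u ∧ v < u)) → (∀ t, (Literature.Geometry.DiscreteGeometry.bondGraph η y).Adj v t → ((∀ p ∈ Pc v, ∀ p' ∈ Pc t, mc v p = mc t p' → D v + Q v p = D t + Q t p') ∧ (∀ p ∈ Pc v, mc v p = t → D v + Q v p = D t) ∧ (∀ p' ∈ Pc t, mc t p' = v → D t + Q t p' = D v)))) →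
    ∃ (D' : Fin N → EuclideanSpace ℝ (Fin 3)) (Q' : Fin N → EuclideanSpace ℝ (Fin 3) →ₗᵢ[ℝ] EuclideanSpace ℝ (Fin 3)),
      ∀ v, ((f v < f u ∨ (f v = f u ∧ v < u)) ∨ v = u) → (∀ t, (Literature.Geometry.DiscreteGeometry.bondGraph η y).Adj v t → ((∀ p ∈ Pc v, ∀ p' ∈ Pc t, mc v p = mc t p' → D' v + Q' v p = D' t + Q' t p') ∧ (∀ p ∈ Pc v, mc v p = t → D' v + Q' v p = D' t) ∧ (∀ p' ∈ Pc t, mc t p' = v → D' t + Q' t p' = D' v))) := by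
  intro η N y Pc Ac mc f R₁ hscope hO hX h1 u hu D Q hgood
  classical
  -- scope bookkeeping
  have scope_u : (f u ≤ R₁ ∨ ∃ w, (bondGraph η y).Adj w u ∧ f w ≤ R₁) := Or.inl hu
  have scope_nbr : ∀ t, (bondGraph η y).Adj u t → (f t ≤ R₁ ∨ ∃ w, (bondGraph η y).Adj w t ∧ f w ≤ R₁) := fun t h => Or.inr ⟨u, h, hu⟩
  have scope_early : ∀ v, (f v < f u ∨ (f v = f u ∧ v < u)) → (f v ≤ R₁ ∨ ∃ w, (bondGraph η y).Adj w v ∧ f w ≤ R₁) := by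
    intro v hv
    refine Or.inl (le_trans ?_ hu)
    rcases hv with h | ⟨h, -⟩
    · exact h.le
    · exact h.le
  have scope_early_nbr : ∀ v t, (f v < f u ∨ (f v = f u ∧ v < u)) → (bondGraph η y).Adj v t →
      (f t ≤ R₁ ∨ ∃ w, (bondGraph η y).Adj w t ∧ f w ≤ R₁) := by
    intro v t hv hvt
    refine Or.inr ⟨v, hvt, le_trans ?_ hu⟩
    rcases hv with h | ⟨h, -⟩
    · exact h.le
    · exact h.le
  -- the triangle rule for the frames `D, Q`
  have tri : ∀ c v t : Fin N, (f c ≤ R₁ ∨ ∃ w, (bondGraph η y).Adj w c ∧ f w ≤ R₁) → (f v ≤ R₁ ∨ ∃ w, (bondGraph η y).Adj w v ∧ f w ≤ R₁) → (f t ≤ R₁ ∨ ∃ w, (bondGraph η y).Adj w t ∧ f w ≤ R₁) →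
      (bondGraph η y).Adj c v → (bondGraph η y).Adj c t → (bondGraph η y).Adj v t →
      ((∀ p ∈ Pc c, ∀ p' ∈ Pc v, mc c p = mc v p' → D c + Q c p = D v + Q v p') ∧ (∀ p ∈ Pc c, mc c p = v → D c + Q c p = D v) ∧ (∀ p' ∈ Pc v, mc v p' = c → D v + Q v p' = D c)) → ((∀ p ∈ Pc c, ∀ p' ∈ Pc t, mc c p = mc t p' → D c + Q c p = D t + Q t p') ∧ (∀ p ∈ Pc c, mc c p = t → D c + Q c p = D t) ∧ (∀ p' ∈ Pc t, mc t p' = c → D t + Q t p' = D c)) → ((∀ p ∈ Pc v, ∀ p' ∈ Pc t, mc v p = mc t p' → D v + Q v p = D t + Q t p') ∧ (∀ p ∈ Pc v, mc v p = t → D v + Q v p = D t) ∧ (∀ p' ∈ Pc t, mc t p' = v → D t + Q t p' = D v)) := by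
    intro c v t sc sv st hcv hct hvt Ccv Cct
    refine develop_triangle η N y Pc Ac mc c v t ?_ (hscope c sc).1 (hscope v sv).1 hcv hct hvt ?_
      D Q Ccv Cct
    · intro w hw
      rcases hw with rfl | rfl | rfl
      · exact (hscope _ sc).2
      · exact (hscope _ sv).2
      · exact (hscope _ st).2
    · intro j k hjk
      rcases hjk with ⟨rfl, rfl⟩ | ⟨rfl, rfl⟩ | ⟨rfl, rfl⟩
      · exact hO _ _ sc sv hcv
      · exact hO _ _ sc st hct
      · exact hO _ _ sv st hvt
  -- symmetry of compatibility
  have csymm : ∀ j k : Fin N, ((∀ p ∈ Pc j, ∀ p' ∈ Pc k, mc j p = mc k p' → D j + Q j p = D k + Q k p') ∧ (∀ p ∈ Pc j, mc j p = k → D j + Q j p = D k) ∧ (∀ p' ∈ Pc k, mc k p' = j → D k + Q k p' = D j)) → ((∀ p ∈ Pc k, ∀ p' ∈ Pc j, mc k p = mc j p' → D k + Q k p = D j + Q j p') ∧ (∀ p ∈ Pc k, mc k p = j → D k + Q k p = D j) ∧ (∀ p' ∈ Pc j, mc j p' = k → D j + Q j p' = D k)) :=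
    fun j k H => ⟨fun p' hp' p hp h => (H.1 p hp p' hp' h.symm).symm, H.2.2, H.2.1⟩
  -- the extensions of the frame of `u` to its neighbours
  have hext : ∀ t : Fin N, ∃ (D₁ : EuclideanSpace ℝ (Fin 3)) (Q₁ : EuclideanSpace ℝ (Fin 3) →ₗᵢ[ℝ] EuclideanSpace ℝ (Fin 3)), (bondGraph η y).Adj u t →
      (∀ p ∈ Pc u, ∀ p' ∈ Pc t, mc u p = mc t p' → D u + Q u p = D₁ + Q₁ p') ∧
      (∀ p ∈ Pc u, mc u p = t → D u + Q u p = D₁) ∧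
      (∀ p' ∈ Pc t, mc t p' = u → D₁ + Q₁ p' = D u) := by
    intro t
    by_cases hut : (bondGraph η y).Adj u t
    · obtain ⟨hνu, hPu, Cu2, Cu3, Cu4, Cu5⟩ := hscope u scope_u
      obtain ⟨-, hPt, Ct2, Ct3, Ct4, Ct5⟩ := hscope t (scope_nbr t hut)
      obtain ⟨D₁, Q₁, h⟩ := develop_extend η N y u t hνu hut (Pc u) (Ac u) (mc u) hPu Cu2 Cu3 Cu4 Cu5
        (Pc t) (Ac t) (mc t) hPt Ct2 Ct3 Ct4 Ct5 (D u) (Q u)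
      exact ⟨D₁, Q₁, fun _ => h⟩
    · exact ⟨0, LinearIsometry.id, fun h => absurd h hut⟩
  choose Dx Qx hx using hext
  -- the new frames: reassign exactly the neighbours of `u` not reached from an earlier site
  set New : Fin N → Prop := fun t => (bondGraph η y).Adj u t ∧ ¬ (f t < f u ∨ (f t = f u ∧ t < u)) ∧
    ¬ ∃ k, (f k < f u ∨ (f k = f u ∧ k < u)) ∧ (bondGraph η y).Adj k t with hNew
  refine ⟨fun t => if New t then Dx t else D t, fun t => if New t then Qx t else Q t, ?_⟩
  have not_new_u : ¬ New u := fun h => h.1.ne rfl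
  have not_new_early : ∀ v, (f v < f u ∨ (f v = f u ∧ v < u)) → ¬ New v := fun v hv h => h.2.1 hv
  have not_new_framed : ∀ v t, (f v < f u ∨ (f v = f u ∧ v < u)) → (bondGraph η y).Adj v t → ¬ New t :=
    fun v t hv hvt h => h.2.2 ⟨v, hv, hvt⟩
  intro v hv
  rcases hv with hv | hv
  · -- an earlier site: nothing changed on its star
    intro t hvt
    have h1' : ¬ New v := not_new_early v hv
    have h2' : ¬ New t := not_new_framed v t hv hvt
    simp only [if_neg h1', if_neg h2']
    exact hgood v hv t hvt
  · -- the new site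
    subst hv
    intro t hut
    by_cases hNt : New t
    · -- a freshly framed neighbour
      simp only [if_neg not_new_u, if_pos hNt]
      exact hx t hut
    · simp only [if_neg not_new_u, if_neg hNt]
      by_cases hte : (f t < f v ∨ (f t = f v ∧ t < v))
      · -- `t` is earlier: use its own goodness
        exact csymm t v (hgood t hte v hut.symm)
      · -- `t` is later and framed from an earlier site `k`
        have hk : ∃ k, (f k < f v ∨ (f k = f v ∧ k < v)) ∧ (bondGraph η y).Adj k t := by
          by_contra hcon
          exact hNt ⟨hut, hte, hcon⟩
        obtain ⟨k, hk, hkt⟩ := hk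
        have hlate : (f v < f t ∨ (f v = f t ∧ v < t)) := by
          rcases lt_trichotomy (f v) (f t) with h | h | h
          · exact Or.inl h
          · rcases lt_trichotomy v t with h' | h' | h'
            · exact Or.inr ⟨h, h'⟩
            · exact absurd h' hut.ne
            · exact absurd (Or.inr ⟨h.symm, h'⟩) hte
          · exact absurd (Or.inl h) hte
        by_cases hvk : (bondGraph η y).Adj v k
        · -- `k` is a common earlier neighbour
          exact tri k v t (scope_early k hk) scope_u (scope_nbr t hut) hvk.symm hkt hut
            (hgood k hk v hvk.symm) (hgood k hk t hkt)
        · have hvk' : v ≠ k := by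
            rintro rfl
            rcases hk with h | ⟨-, h⟩
            · exact lt_irrefl _ h
            · exact lt_irrefl _ h
          obtain ⟨c, hvc, hc, hct⟩ := h1 v t k hu hut hkt.symm hvk hvk' hk hlate
          by_cases hct' : (bondGraph η y).Adj c t
          · -- an earlier common neighbour `c` of `v, t`
            exact tri c v t (scope_early c hc) scope_u (scope_nbr t hut) hvc.symm hct' hut
              (hgood c hc v hvc.symm) (hgood c hc t hct')
          · -- an earlier neighbour `c` of `v` bonded to `k`: the coned square
            have hck : (bondGraph η y).Adj c k := hct.resolve_left hct'
            have hct_ne : c ≠ t := by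
              rintro rfl
              exact hte hc
            have hfc : f c ≤ R₁ := by
              refine le_trans ?_ hu
              rcases hc with h | ⟨h, -⟩
              · exact h.le
              · exact h.le
            obtain ⟨c', hcc', hvc', hkc', htc'⟩ :=
              hX c v k t hfc hvc.symm hck hvk hvk' hct' hct_ne hut.symm hkt.symm
            have sc := scope_early c hc
            have sk := scope_early k hk
            have sc' := scope_early_nbr c c' hc hcc'
            have st := scope_nbr t hut
            have C1 := tri c c' v sc sc' scope_u hcc' hvc.symm hvc'.symm (hgood c hc c' hcc')
              (hgood c hc v hvc.symm)
            have C2 := tri c c' k sc sc' sk hcc' hck hkc'.symm (hgood c hc c' hcc') (hgood c hc k hck)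
            have C3 := tri k c' t sk sc' st hkc' hkt htc'.symm (csymm _ _ C2) (hgood k hk t hkt)
            exact tri c' v t sc' scope_u st hvc'.symm htc'.symm hut C1 C3

end Summit.AtomisticToContinuum.Crystallization.Theorems

end
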